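import Summits.QuantumFields.BalabanUV.Beta.GAN24.DirichletBoxTwoLevel

/-!
# T⁴ programme, spine node NE2 (U1a), sub-row Δ1 «NE2⁰-Dirichlet» — THE WEIGHTED ENERGY IDENTITY ON THE LATTICE TORUS (discrete
# ground-state / IMS identity): `Σ_b ρ̄_b‖∂_b z‖² = Re⟨ρz, Δz⟩ + ½‖c‖²·Σ_x (Δ₁ρ)(x)|z(x)|²`, and its Cauchy–Schwarz form for a function
# supported in a region

NE2 formalisation swarm `b2b-balaban-t4-ne2-formalise-*`, LEAF PROVER 09 (gen 10), supplier item «Δ1-SCALAR-CORNER-H2» file 3 (journal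
`HOME/CLAIMS.log` 2026-08-21 l.23790 / l.24306; memo `t4/T4-EST-NE2-D1-CORNER.md` §4 (W-E)(b), route r3/r5).  Every weighted-energy (Hardy-,
Agmon-, Kondrat'ev-type) estimate for the zero-extended region Dirichlet solution near the re-entrant edges starts from one exact identity: for
a REAL weight `ρ` and ANY `z` on the torus,

  `Σ_μ Σ_x ½(ρ(x) + ρ(x+e_μ))·‖(∂_μ z)(x)‖² = Re⟨ρz, Δz⟩ + ½‖c‖²·Σ_x (Σ_μ (ρ(x+e_μ) + ρ(x−e_μ) − 2ρ(x)))·‖z(x)‖²`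

(`∂_μ = sdiff N c μ`, `Δ = LapS N c = Σ_μ ∂_μᴴ∂_μ`; the last factor is the unit-lattice Laplacian of the weight).  With `ρ ≡ 1` it is
`Σ_μ‖∂_μz‖² = Re⟨z, Δz⟩`; with `ρ = dist(·, E)^{−2s}` it is the Hardy-type bookkeeping of the memo: the weighted energy is the weighted pairing
with `Δz` PLUS a term carrying the (lattice) Laplacian of the weight, to be absorbed by a sector Hardy / Poincaré inequality near the edges.

 * §1 **`weighted_energy_identity`** (exact, every real `ρ`, every `z`, every `c`);
 * §2 for `z` supported in a finite `Ω`: `⟨ρz, Δz⟩` only sees `Ω` (**`star_weight_mul_dotProduct_eq`**) and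
   **`weighted_energy_le`**: `Σ_μΣ_x ρ̄‖∂_μz‖² ≤ √(Σ_{x∈Ω} ρ(x)²‖z(x)‖²)·√(Σ_{x∈Ω}‖(Δz)(x)‖²) + ½‖c‖²·Σ_x (Δ₁ρ)(x)‖z(x)‖²`;
 * §3 in road P2's currency (`c = n`, `z = solExt f` on `Ω = blockReg n S`, gan24's `sum_normSq_LapS_solExt_le`):
   **`weighted_energy_solExt_le`**: `… ≤ √(Σ_Ω ρ²‖z‖²)·√(2(1 + (a′γ′⁻¹)²)·nsq f) + ½n²·Σ_x (Δ₁ρ)(x)‖z(x)‖²` on ANY union of unit blocks.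

HONEST FRAMING (T4-DAG p. 1).  [folklore] finite lattice calculus (summation by parts on the torus); no weight is constructed and no Hardy
inequality is proved here — this is the bookkeeping identity only; nothing about [B9]'s printed regions; `hinjK` ∕ W3 off boxes OPEN; Δ1 NOT
closed; NE2 (U1a) NOT proved; spine PROVED 0/9 unchanged; NOT [B9] (3.16)/(3.23)–(3.27)/(3.42) as printed; NOT infinite volume, NOT a mass
gap, NOT the Clay problem.  HONEST DEPENDENCY: continuum YM on T⁴ ⇐ BetaPertH ∧ nine spine estimates (0/9 proved); BetaPertH ⇐ (D1) ∧ (D4)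
∧ CAP+tail; G-an2-4 gates asym, D1 and NE2/3/4.  No `sorry`.
-/

noncomputable section

open scoped BigOperators ComplexConjugate Matrix
open Finset

namespace Summit.QuantumFields.BalabanUV.T4Continuum.DirichletWeightedEnergy

open Literature.MathematicalPhysics.QuantumFieldTheory.Balaban1983to89.B5Prop11Plancherel (Tor fine unitVec)
open Literature.MathematicalPhysics.QuantumFieldTheory.Balaban1983to89.B5Action121 (sdiff LapS sdiff_mulVec LapS_mulVec)
open Literature.MathematicalPhysics.QuantumFieldTheory.Balaban1983to89.B5Prop11Lower (nsq nsq_nonneg norm_star_dotProduct_le)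
open Summit.QuantumFields.BalabanUV.T4Continuum
open Summit.QuantumFields.BalabanUV.T4Continuum.ScalarAveragedPropagator (gammaPs gammaPs_pos)
open Summit.QuantumFields.BalabanUV.Beta.GAN24.DirichletBoxRegularity (SuppIn)
open Summit.QuantumFields.BalabanUV.Beta.GAN24.DirichletBoxCompression (solExt solExt_apply_of_not sum_normSq_LapS_solExt_le)
open Summit.QuantumFields.BalabanUV.Beta.GAN24.DirichletBoxTrace (blockReg)

variable {d : ℕ} {N : Fin d → ℕ} [hN : ∀ μ, NeZero (N μ)]

/-! ## §1 The identity -/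

/-- the pointwise real-part identity behind the summation by parts:
`Re(conj(ρ′z′ − ρz)·(z′ − z)) = ½(ρ + ρ′)‖z′ − z‖² + ½(ρ′ − ρ)(‖z′‖² − ‖z‖²)`. [folklore] -/
theorem re_conj_sub_mul_sub (ρ ρ' : ℝ) (z z' : ℂ) :
    (conj ((ρ' : ℂ) * z' - (ρ : ℂ) * z) * (z' - z)).re
      = (ρ + ρ') / 2 * ‖z' - z‖ ^ 2 + (ρ' - ρ) / 2 * (‖z'‖ ^ 2 - ‖z‖ ^ 2) := by
  have key : ∀ w : ℂ, ‖w‖ ^ 2 = w.re ^ 2 + w.im ^ 2 := fun w => by rw [Complex.sq_norm, Complex.normSq_apply]; ring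
  rw [key, key, key]
  simp only [map_sub, map_mul, Complex.conj_ofReal, Complex.sub_re, Complex.sub_im, Complex.mul_re, Complex.mul_im,
    Complex.conj_re, Complex.conj_im, Complex.ofReal_re, Complex.ofReal_im]
  ring

/-- `‖z′ − z‖² = ‖z′‖² + ‖z‖² − 2Re(conj z · z′)`. [folklore] -/
theorem normSq_sub_eq (z z' : ℂ) : ‖z' - z‖ ^ 2 = ‖z'‖ ^ 2 + ‖z‖ ^ 2 - 2 * (conj z * z').re := by
  have key : ∀ w : ℂ, ‖w‖ ^ 2 = w.re ^ 2 + w.im ^ 2 := fun w => by rw [Complex.sq_norm, Complex.normSq_apply]; ring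
  rw [key, key, key]
  simp only [Complex.sub_re, Complex.sub_im, Complex.mul_re, Complex.conj_re, Complex.conj_im]
  ring

/-- a shifted torus sum is the unshifted one. [folklore] -/
theorem sum_shift (μ : Fin d) (F : Tor N → ℝ) : ∑ x, F (x + unitVec N μ) = ∑ x, F x :=
  Fintype.sum_equiv (Equiv.addRight (unitVec N μ)) _ _ fun _ => rfl

/-- the energy of one direction as a pointwise sum: `‖(∂_μz)(x)‖² = ‖c‖²·‖z(x+e_μ) − z(x)‖²`. [folklore] -/
theorem normSq_sdiff_apply (c : ℂ) (μ : Fin d) (z : Tor N → ℂ) (x : Tor N) :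
    ‖(sdiff N c μ *ᵥ z) x‖ ^ 2 = ‖c‖ ^ 2 * ‖z (x + unitVec N μ) - z x‖ ^ 2 := by
  rw [sdiff_mulVec, norm_mul, mul_pow]

/-- **THE WEIGHTED ENERGY IDENTITY** (every real weight `ρ`, every `z`, every lattice factor `c`):
`Σ_μ Σ_x ½(ρ(x) + ρ(x+e_μ))·‖(∂_μz)(x)‖² = Re⟨ρz, Δz⟩ + ½‖c‖²·Σ_x (Σ_μ (ρ(x+e_μ) + ρ(x−e_μ) − 2ρ(x)))·‖z(x)‖²`. [folklore] -/
theorem weighted_energy_identity (c : ℂ) (ρ : Tor N → ℝ) (z : Tor N → ℂ) :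
    ∑ μ, ∑ x, (ρ x + ρ (x + unitVec N μ)) / 2 * ‖(sdiff N c μ *ᵥ z) x‖ ^ 2
      = (star (fun x => (ρ x : ℂ) * z x) ⬝ᵥ (LapS N c *ᵥ z)).re
        + ‖c‖ ^ 2 / 2 * ∑ x, (∑ μ, (ρ (x + unitVec N μ) + ρ (x - unitVec N μ) - 2 * ρ x)) * ‖z x‖ ^ 2 := by
  -- the pairing, pointwise: `Re(conj(ρ(x)z(x))·(Δz)(x)) = ‖c‖² Σ_μ ρ(x)·(2‖z x‖² − Re(conj(z x) z(x+e)) − Re(conj(z x) z(x−e)))`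
  have hpair : (star (fun x => (ρ x : ℂ) * z x) ⬝ᵥ (LapS N c *ᵥ z)).re
      = ∑ μ, ∑ x, ‖c‖ ^ 2 * ρ x * (2 * ‖z x‖ ^ 2 - (conj (z x) * z (x + unitVec N μ)).re - (conj (z x) * z (x - unitVec N μ)).re) := by
    rw [dotProduct, Complex.re_sum, Finset.sum_comm]
    refine sum_congr rfl fun x _ => ?_
    rw [LapS_mulVec, mul_sum, Complex.re_sum]
    refine sum_congr rfl fun μ _ => ?_
    have key : ∀ w : ℂ, ‖w‖ ^ 2 = w.re ^ 2 + w.im ^ 2 := fun w => by rw [Complex.sq_norm, Complex.normSq_apply]; ring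
    have hc : ‖c‖ ^ 2 = c.re ^ 2 + c.im ^ 2 := key c
    rw [Pi.star_apply, key (z x), hc]
    simp only [star_mul', Complex.star_def, Complex.conj_ofReal, Complex.mul_re, Complex.sub_re, Complex.ofReal_re,
      Complex.ofReal_im, Complex.conj_re, Complex.conj_im, Complex.mul_im, Complex.sub_im, Complex.re_ofNat, Complex.im_ofNat]
    ring
  -- the weight term as a double sum
  have hW : ‖c‖ ^ 2 / 2 * ∑ x, (∑ μ, (ρ (x + unitVec N μ) + ρ (x - unitVec N μ) - 2 * ρ x)) * ‖z x‖ ^ 2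
      = ∑ μ, ∑ x, ‖c‖ ^ 2 / 2 * ((ρ (x + unitVec N μ) + ρ (x - unitVec N μ) - 2 * ρ x) * ‖z x‖ ^ 2) := by
    rw [Finset.sum_comm, mul_sum]
    refine sum_congr rfl fun x _ => ?_
    rw [sum_mul, mul_sum]
  rw [hpair, hW, ← sum_add_distrib]
  refine sum_congr rfl fun μ _ => ?_
  rw [← sum_add_distrib]
  -- per direction: expand the energy pointwise and reindex the shifted sums
  have hL : ∑ x, (ρ x + ρ (x + unitVec N μ)) / 2 * ‖(sdiff N c μ *ᵥ z) x‖ ^ 2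
      = ∑ x, ‖c‖ ^ 2 * ((ρ x + ρ (x + unitVec N μ)) / 2
          * (‖z (x + unitVec N μ)‖ ^ 2 + ‖z x‖ ^ 2 - 2 * (conj (z x) * z (x + unitVec N μ)).re)) := by
    refine sum_congr rfl fun x _ => ?_
    rw [normSq_sdiff_apply, normSq_sub_eq]
    ring
  rw [hL]
  -- the shifted sums
  have s1 : ∑ x, ρ (x + unitVec N μ) * ‖z (x + unitVec N μ)‖ ^ 2 = ∑ x, ρ x * ‖z x‖ ^ 2 :=
    sum_shift μ (fun x => ρ x * ‖z x‖ ^ 2)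
  have s2 : ∑ x, ρ x * ‖z (x + unitVec N μ)‖ ^ 2 = ∑ x, ρ (x - unitVec N μ) * ‖z x‖ ^ 2 := by
    have := sum_shift (N := N) μ (fun x => ρ (x - unitVec N μ) * ‖z x‖ ^ 2)
    simp only [add_sub_cancel_right] at this
    exact this
  have s3 : ∑ x, ρ (x + unitVec N μ) * (conj (z x) * z (x + unitVec N μ)).re = ∑ x, ρ x * (conj (z x) * z (x - unitVec N μ)).re := by
    have := sum_shift (N := N) μ (fun x => ρ x * (conj (z x) * z (x - unitVec N μ)).re)
    simp only [add_sub_cancel_right] at this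
    rw [← this]
    exact sum_congr rfl fun x _ => by
      congr 1
      simp only [Complex.mul_re, Complex.conj_re, Complex.conj_im]; ring
  -- expand both sides into the elementary sums and compare
  have eL : ∑ x, ‖c‖ ^ 2 * ((ρ x + ρ (x + unitVec N μ)) / 2
          * (‖z (x + unitVec N μ)‖ ^ 2 + ‖z x‖ ^ 2 - 2 * (conj (z x) * z (x + unitVec N μ)).re))
      = ‖c‖ ^ 2 * ((∑ x, ρ x * ‖z (x + unitVec N μ)‖ ^ 2) / 2 + (∑ x, ρ (x + unitVec N μ) * ‖z (x + unitVec N μ)‖ ^ 2) / 2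
          + (∑ x, ρ x * ‖z x‖ ^ 2) / 2 + (∑ x, ρ (x + unitVec N μ) * ‖z x‖ ^ 2) / 2
          - ∑ x, ρ x * (conj (z x) * z (x + unitVec N μ)).re - ∑ x, ρ (x + unitVec N μ) * (conj (z x) * z (x + unitVec N μ)).re) := by
    rw [← mul_sum]
    congr 1
    simp only [sum_div, ← sum_add_distrib, ← sum_sub_distrib]
    exact sum_congr rfl fun x _ => by ring
  have eR : ∑ x, (‖c‖ ^ 2 * ρ x * (2 * ‖z x‖ ^ 2 - (conj (z x) * z (x + unitVec N μ)).re - (conj (z x) * z (x - unitVec N μ)).re)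
        + ‖c‖ ^ 2 / 2 * ((ρ (x + unitVec N μ) + ρ (x - unitVec N μ) - 2 * ρ x) * ‖z x‖ ^ 2))
      = ‖c‖ ^ 2 * (2 * ∑ x, ρ x * ‖z x‖ ^ 2 - ∑ x, ρ x * (conj (z x) * z (x + unitVec N μ)).re
          - ∑ x, ρ x * (conj (z x) * z (x - unitVec N μ)).re
          + (∑ x, ρ (x + unitVec N μ) * ‖z x‖ ^ 2) / 2 + (∑ x, ρ (x - unitVec N μ) * ‖z x‖ ^ 2) / 2 - ∑ x, ρ x * ‖z x‖ ^ 2) := by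
    simp only [mul_sum, sum_div, ← sum_add_distrib, ← sum_sub_distrib]
    exact sum_congr rfl fun x _ => by ring
  rw [eL, eR, s1, s2, s3]
  ring

/-! ## §2 Supported in a region: the Cauchy–Schwarz form -/

/-- for `z` supported in `Ω`, the weighted pairing only sees `Ω`:
`⟨ρz, Δz⟩ = ⟨ρz, 𝟙_Ω·Δz⟩`. [folklore] -/
theorem star_weight_mul_dotProduct_eq {Ω : Finset (Tor N)} {z : Tor N → ℂ} (hz : SuppIn N Ω z) (c : ℂ) (ρ : Tor N → ℝ) :
    star (fun x => (ρ x : ℂ) * z x) ⬝ᵥ (LapS N c *ᵥ z)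
      = star (fun x => (ρ x : ℂ) * z x) ⬝ᵥ (fun x => if x ∈ Ω then (LapS N c *ᵥ z) x else 0) := by
  simp only [dotProduct, Pi.star_apply]
  refine sum_congr rfl fun x _ => ?_
  by_cases hx : x ∈ Ω
  · rw [if_pos hx]
  · rw [if_neg hx, hz x hx, mul_zero, star_zero, zero_mul, zero_mul]

/-- the truncated vector's norm: `nsq (𝟙_Ω·Δz) = Σ_{x∈Ω}‖(Δz)(x)‖²`. [folklore] -/
theorem nsq_indicator_LapS (Ω : Finset (Tor N)) (c : ℂ) (z : Tor N → ℂ) :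
    nsq (fun x => if x ∈ Ω then (LapS N c *ᵥ z) x else 0) = ∑ x ∈ Ω, ‖(LapS N c *ᵥ z) x‖ ^ 2 := by
  unfold nsq
  rw [← sum_filter_add_sum_filter_not univ (· ∈ Ω)]
  have h1 : ∑ x ∈ univ.filter (· ∈ Ω), ‖(if x ∈ Ω then (LapS N c *ᵥ z) x else 0)‖ ^ 2 = ∑ x ∈ Ω, ‖(LapS N c *ᵥ z) x‖ ^ 2 := by
    have hs : univ.filter (· ∈ Ω) = Ω := by ext x; simp
    rw [hs]
    exact sum_congr rfl fun x hx => by rw [if_pos hx]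
  have h2 : ∑ x ∈ univ.filter (fun x => ¬ x ∈ Ω), ‖(if x ∈ Ω then (LapS N c *ᵥ z) x else 0)‖ ^ 2 = 0 :=
    sum_eq_zero fun x hx => by rw [if_neg (mem_filter.mp hx).2, norm_zero, zero_pow two_ne_zero]
  rw [h1, h2, add_zero]

/-- the weighted vector's norm: `nsq (ρz) = Σ_{x∈Ω} ρ(x)²‖z(x)‖²` for `z` supported in `Ω`. [folklore] -/
theorem nsq_weight_mul {Ω : Finset (Tor N)} {z : Tor N → ℂ} (hz : SuppIn N Ω z) (ρ : Tor N → ℝ) :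
    nsq (fun x => (ρ x : ℂ) * z x) = ∑ x ∈ Ω, ρ x ^ 2 * ‖z x‖ ^ 2 := by
  unfold nsq
  rw [← sum_filter_add_sum_filter_not univ (· ∈ Ω)]
  have hs : univ.filter (· ∈ Ω) = Ω := by ext x; simp
  have h2 : ∑ x ∈ univ.filter (fun x => ¬ x ∈ Ω), ‖(ρ x : ℂ) * z x‖ ^ 2 = 0 :=
    sum_eq_zero fun x hx => by rw [hz x (mem_filter.mp hx).2, mul_zero, norm_zero, zero_pow two_ne_zero]
  rw [hs, h2, add_zero]
  exact sum_congr rfl fun x _ => by rw [norm_mul, Complex.norm_real, Real.norm_eq_abs, mul_pow, sq_abs]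

/-- **THE WEIGHTED ENERGY INEQUALITY FOR A SUPPORTED FUNCTION**:
`Σ_μΣ_x ½(ρ(x)+ρ(x+e_μ))‖(∂_μz)(x)‖² ≤ √(Σ_{x∈Ω} ρ(x)²‖z(x)‖²)·√(Σ_{x∈Ω}‖(Δz)(x)‖²) + ½‖c‖²·Σ_x (Δ₁ρ)(x)‖z(x)‖²`. [folklore] -/
theorem weighted_energy_le {Ω : Finset (Tor N)} {z : Tor N → ℂ} (hz : SuppIn N Ω z) (c : ℂ) (ρ : Tor N → ℝ) :
    ∑ μ, ∑ x, (ρ x + ρ (x + unitVec N μ)) / 2 * ‖(sdiff N c μ *ᵥ z) x‖ ^ 2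
      ≤ Real.sqrt (∑ x ∈ Ω, ρ x ^ 2 * ‖z x‖ ^ 2) * Real.sqrt (∑ x ∈ Ω, ‖(LapS N c *ᵥ z) x‖ ^ 2)
        + ‖c‖ ^ 2 / 2 * ∑ x, (∑ μ, (ρ (x + unitVec N μ) + ρ (x - unitVec N μ) - 2 * ρ x)) * ‖z x‖ ^ 2 := by
  rw [weighted_energy_identity c ρ z]
  refine add_le_add ?_ le_rfl
  rw [star_weight_mul_dotProduct_eq hz c ρ]
  refine (Complex.re_le_norm _).trans ?_
  rw [← nsq_weight_mul hz ρ, ← nsq_indicator_LapS Ω c z]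
  exact norm_star_dotProduct_le _ _

/-! ## §3 In road P2's currency: the zero-extended region Dirichlet solution -/

section Region

variable (n : ℕ) [NeZero n] (M : Fin d → ℕ) [hM : ∀ μ, NeZero (M μ)] (S : Tor M → Prop) [DecidablePred S] {a' : ℝ}

/-- **THE WEIGHTED ENERGY OF A REGION DIRICHLET SOLUTION ON ANY UNION OF UNIT BLOCKS** (`a′ > 0`, any decidable spelling `p` of
`Ω = blockReg n S`, any real weight `ρ`):
`Σ_μΣ_x ½(ρ(x)+ρ(x+e_μ))‖(∂_μ solExt f)(x)‖² ≤ √(Σ_{x∈Ω} ρ(x)²‖solExt f (x)‖²)·√(2(1 + (a′γ′⁻¹)²)·‖f‖²) + ½n²·Σ_x (Δ₁ρ)(x)‖solExt f (x)‖²`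
(gan24's `sum_normSq_LapS_solExt_le` for the `Δz` factor). [folklore] -/
theorem weighted_energy_solExt_le (ha' : 0 < a') (p : Tor (fine n M) → Prop) [DecidablePred p] (hp : ∀ x, p x ↔ blockReg n M S x)
    (ρ : Tor (fine n M) → ℝ) (f : {x // p x} → ℂ) :
    ∑ μ, ∑ x, (ρ x + ρ (x + unitVec (fine n M) μ)) / 2 * ‖(sdiff (fine n M) (n : ℂ) μ *ᵥ solExt n M a' p f) x‖ ^ 2
      ≤ Real.sqrt (∑ x ∈ univ.filter (blockReg n M S), ρ x ^ 2 * ‖solExt n M a' p f x‖ ^ 2)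
          * Real.sqrt (2 * (1 + (a' * (gammaPs d a')⁻¹) ^ 2) * nsq f)
        + (n : ℝ) ^ 2 / 2 * ∑ x, (∑ μ, (ρ (x + unitVec (fine n M) μ) + ρ (x - unitVec (fine n M) μ) - 2 * ρ x))
            * ‖solExt n M a' p f x‖ ^ 2 := by
  set u := solExt n M a' p f with hu
  set Ω := univ.filter (blockReg n M S) with hΩ
  have hsupp : SuppIn (fine n M) Ω u := by
    intro x hx
    rw [hΩ, Finset.mem_filter] at hx
    exact solExt_apply_of_not n M a' p f (fun h => hx ⟨Finset.mem_univ _, (hp x).mp h⟩)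
  have h1 := weighted_energy_le hsupp (n : ℂ) ρ
  have hn : ‖(n : ℂ)‖ ^ 2 = (n : ℝ) ^ 2 := by rw [Complex.norm_natCast]
  rw [hn] at h1
  have h2 : ∑ x ∈ Ω, ‖(LapS (fine n M) (n : ℂ) *ᵥ u) x‖ ^ 2 = ∑ a : {x // p x}, ‖(LapS (fine n M) (n : ℂ) *ᵥ u) a‖ ^ 2 :=
    Finset.sum_subtype _ (fun x => by simp [hΩ, hp x]) (fun x => ‖(LapS (fine n M) (n : ℂ) *ᵥ u) x‖ ^ 2)
  have h3 := sum_normSq_LapS_solExt_le n M a' p ha' f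
  rw [← hu] at h3
  have hF : Real.sqrt (∑ x ∈ Ω, ‖(LapS (fine n M) (n : ℂ) *ᵥ u) x‖ ^ 2) ≤ Real.sqrt (2 * (1 + (a' * (gammaPs d a')⁻¹) ^ 2) * nsq f) :=
    Real.sqrt_le_sqrt (by rw [h2]; exact h3)
  exact h1.trans (add_le_add (mul_le_mul_of_nonneg_left hF (Real.sqrt_nonneg _)) le_rfl)

end Region

end Summit.QuantumFields.BalabanUV.T4Continuum.DirichletWeightedEnergy

end
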